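import Summits.AtomisticToContinuum.BoseEinsteinCondensation.Theorems.BECThomsonPrincipleGDTransferSeededTransportDefs

/-!
# Route `BECThomsonPrinciple`, crux `GDTransfer` (stmt-AtomisticToContinuum-9482), line `seeded-continuity`
# (skeleton v6): registered stub `stub_scaledCloseBdd`

Supports (does not close) stmt-AtomisticToContinuum-9482.

The registered stub `stub_scaledCloseBdd : Sig.stub_scaledCloseBdd`, i.e. the implication
`PairPotentialBound → DilationL1 → ScaledCloseBdd` of the transport device of
`BECThomsonPrincipleGDTransferSeededTransportDefs.lean`:

* (E) `DilationL1` sandwiches the scaled profile `u_b = b⁻²u(·/b)` between `u` and `u + w` (and `u ≤ u_b + w`)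
  with a bounded, supported, `L¹`-small measurable profile `w`;
* the pointwise sandwich periodises termwise (`vb_periodizedPotential_le_of_pointwise`) and sums over the pairs
  (`periodicInteraction_le_add_of_pointwise`): `W_{u_b} ≤ W_u + W_w` and `W_u ≤ W_{u_b} + W_w` on every
  configuration;
* hence `E_{u_b}(Φ) ≤ E_u(Φ) + ∫ W_w |Φ|²` and symmetrically (`periodicEnergy_le_add_interaction`);
* (D) `PairPotentialBound` bounds the extra term `∫ W_w |Φ|² ≤ ε` on every state of kinetic energy `≤ K`.

All [folklore] bookkeeping on top of the two hypotheses.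
-/

noncomputable section

open MeasureTheory Filter
open scoped ENNReal NNReal

namespace Summit.AtomisticToContinuum.BoseEinsteinCondensation.Cruxes.GDTransfer.Seeded

open Literature.MathematicalPhysics.QuantumManyBody.BoseGas
open Literature.Barriers.AtomisticToContinuum.BoseGas (scaledPotential)
open Summit.AtomisticToContinuum.BoseEinsteinCondensation.Theorems.CorrectorClosure.VolumeHomotopySumRuleDomination
  (vb_periodizedPotential_le_of_pointwise)

namespace ScaledClose

variable {N : ℕ} {L : ℝ}

/-- A pointwise bound `w(|x|) ≤ v(|x|) + u(|x|)` periodises termwise: `w^per ≤ v^per + u^per`. [folklore] -/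
theorem periodizedPotential_le_add_of_pointwise {v w u : ℝ → ℝ≥0∞}
    (h : ∀ x : Space, w ‖x‖ ≤ v ‖x‖ + u ‖x‖) (L : ℝ) (y : Space) :
    periodizedPotential w L y ≤ periodizedPotential v L y + periodizedPotential u L y := by
  have h' : ∀ x : Space, w ‖x‖ ≤ v ‖x‖ + 1 * u ‖x‖ := fun x => by simpa only [one_mul] using h x
  simpa only [one_mul] using vb_periodizedPotential_le_of_pointwise h' L y

/-- A pointwise bound `w(|x|) ≤ v(|x|) + u(|x|)` sums over the pairs: `W_w ≤ W_v + W_u` on every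
configuration. [folklore] -/
theorem periodicInteraction_le_add_of_pointwise {v w u : ℝ → ℝ≥0∞}
    (h : ∀ x : Space, w ‖x‖ ≤ v ‖x‖ + u ‖x‖) (L : ℝ) (X : Config N) :
    periodicInteraction w L X ≤ periodicInteraction v L X + periodicInteraction u L X := by
  unfold periodicInteraction
  calc ∑ i : Fin N, ∑ j ∈ Finset.univ.filter (fun j : Fin N => i < j), periodizedPotential w L (X i - X j)
      ≤ ∑ i : Fin N, ∑ j ∈ Finset.univ.filter (fun j : Fin N => i < j),
          (periodizedPotential v L (X i - X j) + periodizedPotential u L (X i - X j)) :=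
        Finset.sum_le_sum fun i _ => Finset.sum_le_sum fun j _ =>
          periodizedPotential_le_add_of_pointwise h L _
    _ = _ := by
        rw [← Finset.sum_add_distrib]
        exact Finset.sum_congr rfl fun i _ => Finset.sum_add_distrib

/-- **Energies of two potentials whose interactions differ by a third are close**: if `W_w ≤ W_v + W_u` on
every configuration then `E_w(Φ) ≤ E_v(Φ) + ∫_{cell^N} W_u |Φ|²` for every trial state (`u` measurable).
[folklore] -/
theorem periodicEnergy_le_add_interaction {v w u : ℝ → ℝ≥0∞} (hu : Measurable u)
    (h : ∀ X : Config N, periodicInteraction w L X ≤ periodicInteraction v L X + periodicInteraction u L X)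
    (Φ : PeriodicTrialState N L) :
    periodicEnergy w Φ ≤ periodicEnergy v Φ +
      ∫⁻ X in cellN N L, periodicInteraction u L X * (‖Φ.ψ X‖₊ : ℝ≥0∞) ^ 2 := by
  unfold periodicEnergy
  have hm : Measurable fun X : Config N => periodicInteraction u L X * (‖Φ.ψ X‖₊ : ℝ≥0∞) ^ 2 :=
    (measurable_periodicInteraction hu L).mul (measurable_normSq Φ.contDiff.continuous)
  calc ∫⁻ X in cellN N L, kineticDensity Φ.ψ X + periodicInteraction w L X * (‖Φ.ψ X‖₊ : ℝ≥0∞) ^ 2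
      ≤ ∫⁻ X in cellN N L, (kineticDensity Φ.ψ X + periodicInteraction v L X * (‖Φ.ψ X‖₊ : ℝ≥0∞) ^ 2) +
          periodicInteraction u L X * (‖Φ.ψ X‖₊ : ℝ≥0∞) ^ 2 := by
        refine lintegral_mono fun X => ?_
        rw [add_assoc, ← add_mul]
        exact add_le_add le_rfl (mul_le_mul' (h X) le_rfl)
    _ = _ := lintegral_add_right _ hm

end ScaledClose

open ScaledClose in
/-- **Registered stub `stub_scaledCloseBdd`** (skeleton v6, line `seeded-continuity`): the pair-potential bound on
kinetic-bounded states (D) and the `L¹`-continuity of dilations as a two-sided sandwich (E) give the two-sided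
`ε`-closeness of the energies of `u` and of the scaled profile `b⁻²u(·/b)` on every periodic trial state of
kinetic energy `≤ K`, for `b` close to `1`. [folklore] -/
theorem stub_scaledCloseBdd : Sig.stub_scaledCloseBdd := by
  intro hPair hDil u hu B hB R₀ hR₀ m L hL K hK ε hε
  obtain ⟨η, hη, hηw⟩ := hPair m L hL (2 * max R₀ 0) (4 * max B 0) K hK ε hε
  obtain ⟨ϑ, hϑ, hϑb⟩ := hDil u hu B hB R₀ hR₀ η hη
  refine ⟨ϑ, hϑ, fun b hb Φ hΦK => ?_⟩
  obtain ⟨w, hwm, hwB, hwR, hwint, hsand₁, hsand₂⟩ := hϑb b hb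
  have hW := hηw w hwm hwB hwR hwint Φ hΦK
  have hint₁ : ∀ X : Config (m + 1),
      periodicInteraction (scaledPotential u b) L X ≤ periodicInteraction u L X + periodicInteraction w L X :=
    fun X => periodicInteraction_le_add_of_pointwise hsand₁ L X
  have hint₂ : ∀ X : Config (m + 1),
      periodicInteraction u L X ≤ periodicInteraction (scaledPotential u b) L X + periodicInteraction w L X :=
    fun X => periodicInteraction_le_add_of_pointwise hsand₂ L X
  exact ⟨(periodicEnergy_le_add_interaction hwm hint₂ Φ).trans (add_le_add le_rfl hW),
    (periodicEnergy_le_add_interaction hwm hint₁ Φ).trans (add_le_add le_rfl hW)⟩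

end Summit.AtomisticToContinuum.BoseEinsteinCondensation.Cruxes.GDTransfer.Seeded

end
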